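/-
Literature/Probability/FitznerVanDerHofstad2017/SrwWSplitHybridKernel.lean   (NEW, additive, d-generic)

b2b-lace lean1-g22, node N67-S2-K2d-HK: the KERNEL EVALUATOR of the hybrid (disjoint-exact + Jensen) far values of
`SrwWSplitHybrid`, and the `WBX` cell clones consuming them.  What-if / input-certification lane: no statement
about any dimension; the record (CERT REV 14) is untouched.
-/
import Literature.Probability.FitznerVanDerHofstad2017.SrwWSplitJensenKernel
import Literature.Probability.FitznerVanDerHofstad2017.SrwWSplitHybrid
import HarnessLib

/-!
# Kernel evaluator for the hybrid `W`-split far values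

`SrwWSplitHybrid.srwW_le_hybrid_cert` bounds `W_{1,j}(x)` by `α B_xx + (1-α) max(B_xx, B_J)` from a common
majorant `B_xx` of the one-point integrals `I_{1,2j}(x + x∘σ)` over the relative permutations `σ` with
`σ(supp x) ∩ supp x = ∅`, a majorant `B_J` of the Jensen sum, and any `α ≤ #{σ : σS∩S=∅}/d!` (e.g. `1 - s²/d`,
`SrwWSplitHybrid.le_card_disPerms`).  This module makes the three inputs kernel-decidable:

* §1 (symbolic) every disjoint placement `x + x∘σ` has the DOUBLED PROFILE — `#{μ : |(x+x∘σ)_μ| = a} = 2·#{μ :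
  |x_μ| = a}` for `a ≥ 1` (`absCount_add_compPerm`) — hence ONE integral: `I_{n,l}(x + x∘σ) = I_{n,l}(xx)` for any
  point `xx` of the box with that profile (`srwI_add_compPerm_eq`, via `exists_signedPerm_of_absCount_eq`);
* §2 (kernel) for a class `x_l = canonSite d l` the representative `xx = canonSite d (l.map (2·))`, checked by the
  decidable guard `xxGuard` (boxes + profile, levels `1 … maxAbs`), its value `xxBoundQ` = SRW-law partial sum +
  extended origin column (`SrwOriginTailKernel.srwI_one_le_partialQ_add_extQ`; the cap when the guard fails),
  a WEIGHT TABLE `αQ : s ↦ α_s` admissible in the sense `α_{#S}·d! ≤ #{σ : σS∩S=∅}` (`hybAlphaQ d s = 1 - s²/d`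
  is, `hybAlphaQ_admissible`; a sharper certified table can be passed instead), the `W`-majorant
  `hybWBoundQ = min(B_J, α_s B_xx + (1-α_s) max(B_xx, B_J))` (`srwW_le_hybWBoundQ`), the far value `hybFarQ = amgmNewton(A, hybWBoundQ)` with `A = srwIZeroExtQ d Λ T (2J)`
  (`srwK_le_hybFarQ`, through `SrwWSplitHybrid.srwK_le_of_srwW_cert`), the chunkable table form `hybFarLeTable`
  and the `WBX` cells `…_policyXBounds_hybrid_of_originTable` / `…_policyXBounds_hybridTable_of_originTable`
  (clones of the `SrwWSplitJensenKernel` cells through `WbxCellExactKernel.…_of_farValues`).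

Cost: one extra SRW-law partial sum per class (the doubled class) on top of the Jensen evaluator; for `s = 1` the
`W`-majorant is the orbit value up to the table slack.  All statements are `d`-generic.  Pointer language only.

References: [FvdH-NoBLE] R. Fitzner, R. van der Hofstad, PTRF 169 (2017) 1041–1119, §3.5.3, §5.1.2 (5.16), §5.3;
[FvdH17] EJP 22 (2017) no. 43, §4.2; [MS93] N. Madras, G. Slade, The Self-Avoiding Walk (1993), Cor. 5.3.2.
-/

namespace Literature.Probability.FitznerVanDerHofstad2017

open _root_.MeasureTheory Finset
open Literature.Barriers.CriticalPhenomena Literature.Probability.Percolation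
open Literature.Probability.LatticeModels
open SrwCount (coordD)
open scoped BigOperators ENNReal

variable {d : ℕ}

/-! ### §1. Disjoint placements carry the doubled profile -/

/-- For `σ S ∩ S = ∅`: `(x + x∘σ)_μ` is `x_{σμ}` where `x_μ = 0` and `x_μ` elsewhere.
[cite: FitznerVanDerHofstad2016NoBLE, §3.5.3 (3.34) p. 1071] -/
theorem add_compPerm_apply {x : Fin d → ℤ} {σ : Equiv.Perm (Fin d)} (hσ : σ ∈ disPerms (nzSupp x)) (μ : Fin d) :
    (x + compPerm x σ) μ = if x μ = 0 then x (σ μ) else x μ := by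
  have hσ' := (Finset.mem_filter.1 hσ).2
  simp only [Pi.add_apply, compPerm]
  by_cases h : x μ = 0
  · simp [h]
  · have hmem : μ ∈ nzSupp x := by simp [nzSupp, h]
    have h2 : x (σ μ) = 0 := by simpa [nzSupp] using hσ' _ hmem
    simp [h, h2]

/-- A disjoint placement stays in the box of `x`. [cite: FitznerVanDerHofstad2016NoBLE, §3.5.3 (3.34) p. 1071] -/
theorem natAbs_add_compPerm_le {x : Fin d → ℤ} {σ : Equiv.Perm (Fin d)} (hσ : σ ∈ disPerms (nzSupp x)) {r : ℕ}
    (hx : ∀ μ, (x μ).natAbs ≤ r) (μ : Fin d) : ((x + compPerm x σ) μ).natAbs ≤ r := by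
  rw [add_compPerm_apply hσ]
  split_ifs <;> exact hx _

/-- **Doubled profile**: for `σ S ∩ S = ∅` and `a ≥ 1`, `#{μ : |(x + x∘σ)_μ| = a} = 2 · #{μ : |x_μ| = a}`.
[cite: FitznerVanDerHofstad2016NoBLE, §3.5.3 (3.34)–(3.36) p. 1071] -/
theorem absCount_add_compPerm {x : Fin d → ℤ} {σ : Equiv.Perm (Fin d)} (hσ : σ ∈ disPerms (nzSupp x)) {a : ℕ}
    (ha : a ≠ 0) : absCount (x + compPerm x σ) a = 2 * absCount x a := by
  have hσ' := (Finset.mem_filter.1 hσ).2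
  unfold absCount
  have hsplit : (univ.filter fun μ : Fin d => ((x + compPerm x σ) μ).natAbs = a) =
      (univ.filter fun μ : Fin d => (x μ).natAbs = a) ∪
        (univ.filter fun μ : Fin d => x μ = 0 ∧ (x (σ μ)).natAbs = a) := by
    ext μ
    simp only [mem_filter, mem_univ, true_and, mem_union, add_compPerm_apply hσ]
    by_cases h : x μ = 0
    · simp only [h, if_true, Int.natAbs_zero, true_and]
      constructor
      · exact Or.inr
      · rintro (h0 | h1)
        · exact absurd h0.symm ha
        · exact h1
    · simp [h]
  have hdisj : Disjoint (univ.filter fun μ : Fin d => (x μ).natAbs = a)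
      (univ.filter fun μ : Fin d => x μ = 0 ∧ (x (σ μ)).natAbs = a) := by
    rw [Finset.disjoint_filter]
    intro μ _ h1 h2
    rw [h2.1, Int.natAbs_zero] at h1
    exact ha h1.symm
  rw [hsplit, Finset.card_union_of_disjoint hdisj, two_mul]
  congr 1
  refine Finset.card_bij' (fun μ _ => σ μ) (fun i _ => σ.symm i) ?_ ?_ ?_ ?_
  · intro μ hμ
    simp only [mem_filter, mem_univ, true_and] at hμ ⊢
    exact hμ.2
  · intro i hi
    simp only [mem_filter, mem_univ, true_and] at hi ⊢
    refine ⟨?_, by rwa [Equiv.apply_symm_apply]⟩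
    by_contra hne
    have hmem : σ.symm i ∈ nzSupp x := by simp [nzSupp, hne]
    have hout := hσ' _ hmem
    rw [Equiv.apply_symm_apply] at hout
    apply hout
    simp only [nzSupp, mem_filter, mem_univ, true_and]
    intro h0
    rw [h0, Int.natAbs_zero] at hi
    exact ha hi.symm
  · intro μ _; exact Equiv.symm_apply_apply σ μ
  · intro i _; exact Equiv.apply_symm_apply σ i

/-- Level `0` follows from the positive levels (the profile sums to `d`). [cite: FitznerVanDerHofstad2016NoBLE, §5.3.3 p. 1098] -/
theorem absCount_zero_eq_of_forall_ne_zero {r : ℕ} {x y : Site d} (hx : ∀ μ, (x μ).natAbs ≤ r)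
    (hy : ∀ μ, (y μ).natAbs ≤ r) (h : ∀ a, a ≠ 0 → absCount x a = absCount y a) :
    absCount x 0 = absCount y 0 := by
  have hsx := sum_absCount_eq_of_mem_absBox (mem_absBox.2 hx)
  have hsy := sum_absCount_eq_of_mem_absBox (mem_absBox.2 hy)
  rw [Fin.sum_univ_succ] at hsx hsy
  have hrest : ∑ i : Fin r, absCount x ((Fin.succ i : Fin (r + 1)) : ℕ) =
      ∑ i : Fin r, absCount y ((Fin.succ i : Fin (r + 1)) : ℕ) :=
    Finset.sum_congr rfl fun i _ => h _ (by rw [Fin.val_succ]; omega)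
  simp only [Fin.val_zero] at hsx hsy
  omega

/-- **One integral for all disjoint placements**: if `xx` lies in the box of `x` and has the doubled profile at the
levels `1 … r`, then `I_{n,l}(x + x∘σ) = I_{n,l}(xx)` for every `σ` with `σ S ∩ S = ∅`.
[cite: FitznerVanDerHofstad2016NoBLE, §3.5.3 (3.35)–(3.36) p. 1071; §5.3.3 p. 1098] -/
theorem srwI_add_compPerm_eq {x xx : Site d} {σ : Equiv.Perm (Fin d)} (hσ : σ ∈ disPerms (nzSupp x)) {r : ℕ}
    (hx : ∀ μ, (x μ).natAbs ≤ r) (hxx : ∀ μ, (xx μ).natAbs ≤ r)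
    (hprof : ∀ a, 1 ≤ a → a ≤ r → absCount xx a = 2 * absCount x a) (n l : ℕ) :
    srwI d n l (x + compPerm x σ) = srwI d n l xx := by
  have hb : ∀ μ, ((x + compPerm x σ) μ).natAbs ≤ r := natAbs_add_compPerm_le hσ hx
  have hpos : ∀ a, a ≠ 0 → absCount (x + compPerm x σ) a = absCount xx a := by
    intro a ha
    by_cases har : a ≤ r
    · rw [absCount_add_compPerm hσ ha, hprof a (Nat.one_le_iff_ne_zero.2 ha) har]
    · rw [absCount_eq_zero_of_lt hb (not_le.1 har), absCount_eq_zero_of_lt hxx (not_le.1 har)]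
  have hall : ∀ a, absCount (x + compPerm x σ) a = absCount xx a := by
    intro a
    rcases eq_or_ne a 0 with rfl | ha
    · exact absCount_zero_eq_of_forall_ne_zero hb hxx hpos
    · exact hpos a ha
  obtain ⟨τ, ε, h⟩ := exists_signedPerm_of_absCount_eq hall
  rw [h]
  exact ((signedPermInvariant_srwI n l) τ ε _).symm

/-! ### §2. The kernel inputs: representative, guard, `α`, the `W`-majorant -/

/-- The multiplicity list of the doubled class: every multiplicity doubled. [folklore] -/
def dblClass (l : List ℕ) : List ℕ := l.map fun m => 2 * m

/-- The decidable guard: `x` and `xx` lie in the box `|·| ≤ maxAbs x` and `xx` has the doubled profile of `x` at the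
levels `1 … maxAbs x` (a `Bool` conjunction, cheap in the kernel). [folklore] -/
def xxGuard (d : ℕ) (x xx : Fin d → ℤ) : Bool :=
  decide (∀ μ, (x μ).natAbs ≤ maxAbs x) && decide (∀ μ, (xx μ).natAbs ≤ maxAbs x) &&
    (List.range' 1 (maxAbs x)).all fun a => absCount xx a == 2 * absCount x a

/-- What the guard certifies. [cite: FitznerVanDerHofstad2016NoBLE, §5.1.2 (5.16) p. 1092] -/
theorem xxGuard_spec {x xx : Fin d → ℤ} (h : xxGuard d x xx = true) :
    (∀ μ, (x μ).natAbs ≤ maxAbs x) ∧ (∀ μ, (xx μ).natAbs ≤ maxAbs x) ∧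
      ∀ a, 1 ≤ a → a ≤ maxAbs x → absCount xx a = 2 * absCount x a := by
  unfold xxGuard at h
  simp only [Bool.and_eq_true, decide_eq_true_eq, List.all_eq_true, beq_iff_eq] at h
  obtain ⟨⟨hx, hxx⟩, hprof⟩ := h
  refine ⟨hx, hxx, fun a h1 h2 => hprof a ?_⟩
  rw [List.mem_range'_1]
  omega

/-- `B_xx` of class `l` at `D̂`-power `L`: the SRW-law partial sum of depth `N` at the canonical point of the doubled class
plus the extended origin column at `L + N` — or the cap `srwIZeroExtQ d Λ T L` when the representative does not fit
(`2Σl > d`) or the guard fails. [cite: FitznerVanDerHofstad2016NoBLE, §5.1.1 (5.4)–(5.5) pp. 1089–1090; (5.14) p. 1092] -/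
def xxBoundQ (d : ℕ) (l : List ℕ) (L N Λ : ℕ) (T : ℕ → ℚ) : ℚ :=
  if (coordListN 1 (dblClass l)).length ≤ d ∧ xxGuard d (canonSite d l) (canonSite d (dblClass l)) = true then
    srwLawPartialQ d (coordListN 1 (dblClass l)) L N + srwIZeroExtQ d Λ T (L + N)
  else srwIZeroExtQ d Λ T L

/-- **`I_{1,L}(x_l + x_l∘σ) ≤ ↑(xxBoundQ d l L N Λ T)`** for every disjoint `σ` (`d ≥ 3`, origin table `hT`).
[cite: FitznerVanDerHofstad2016NoBLE, §5.1.1 (5.4)–(5.5) pp. 1089–1090; (5.14) p. 1092] -/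
theorem srwI_add_compPerm_le_xxBoundQ (hd : 3 ≤ d) {Λ : ℕ} {T : ℕ → ℚ}
    (hT : ∀ l ≤ Λ, srwI d 1 l 0 ≤ (T l : ℝ)) (l : List ℕ) (L N : ℕ) {σ : Equiv.Perm (Fin d)}
    (hσ : σ ∈ disPerms (nzSupp (canonSite d l))) :
    srwI d 1 L (canonSite d l + compPerm (canonSite d l) σ) ≤ ((xxBoundQ d l L N Λ T : ℚ) : ℝ) := by
  unfold xxBoundQ
  split_ifs with h
  · obtain ⟨hlen, hg⟩ := h
    obtain ⟨hx, hxx, hprof⟩ := xxGuard_spec hg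
    rw [srwI_add_compPerm_eq hσ hx hxx hprof 1 L]
    push_cast
    exact srwI_one_le_partialQ_add_extQ hd hlen (natAbs_coordD_canonSite hlen) hT L N
  · exact (srwI_le_srwI_zero le_rfl (by omega) L _).trans (srwI_one_zero_le_srwIZeroExtQ hd hT L)

/-- `α(d, s) = 1 - s²/d` (`≤ #{σ : σS∩S=∅}/d!`, `SrwWSplitHybrid.le_card_disPerms`). [cite: FitznerVanDerHofstad2016NoBLE, §3.5.3 (3.34) p. 1071] -/
def hybAlphaQ (d s : ℕ) : ℚ := 1 - (s : ℚ) ^ 2 / d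

/-- The union-bound weight is admissible: `α(d, #S) · d! ≤ #{σ : σS∩S=∅}` (`d ≥ 1`) — the shape of the hypothesis `hα`
of the evaluator below, which accepts ANY admissible weight table (e.g. the exact ratio `C(d-s,s)/C(d,s)` once
certified). [cite: FitznerVanDerHofstad2016NoBLE, §3.5.3 (3.34) p. 1071] -/
theorem hybAlphaQ_admissible (hd : 0 < d) (S : Finset (Fin d)) :
    ((hybAlphaQ d S.card : ℚ) : ℝ) * d.factorial ≤ (disPerms S).card := by
  have := le_card_disPerms S hd
  simpa [hybAlphaQ] using this

/-- The hybrid `W`-majorant of class `l` at `D̂`-power `L = 2j` for a weight table `αQ : s ↦ α_s`: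
`min(B_J, α_s B_xx + (1-α_s) max(B_xx, B_J))` with `B_J = jensenBoundQ`, `B_xx = xxBoundQ`, `s = #supp x_l`.
[cite: FitznerVanDerHofstad2016NoBLE, §5.1.2 (5.16) p. 1092] -/
def hybWBoundQ (d : ℕ) (αQ : ℕ → ℚ) (l : List ℕ) (L N tmax Λ : ℕ) (T : ℕ → ℚ) : ℚ :=
  min (jensenBoundQ d (canonSite d l) L N tmax Λ T)
    (αQ (nzSupp (canonSite d l)).card * xxBoundQ d l L N Λ T +
      (1 - αQ (nzSupp (canonSite d l)).card) *
        max (xxBoundQ d l L N Λ T) (jensenBoundQ d (canonSite d l) L N tmax Λ T))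

/-- **`W_{1,j}(x_l) ≤ ↑(hybWBoundQ d αQ l (2j) N tmax Λ T)`** for every ADMISSIBLE weight table
(`hα : α_{#S} · d! ≤ #{σ : σS∩S=∅}` for all `S`; e.g. `hybAlphaQ_admissible`) (`d ≥ 3`, origin table `hT`).
[cite: FitznerVanDerHofstad2016NoBLE, §5.1.2 (5.16) p. 1092; §3.5.3 (3.34)–(3.36) p. 1071] -/
theorem srwW_le_hybWBoundQ (hd : 3 ≤ d) {Λ : ℕ} {T : ℕ → ℚ} (hT : ∀ l ≤ Λ, srwI d 1 l 0 ≤ (T l : ℝ))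
    {αQ : ℕ → ℚ} (hα : ∀ S : Finset (Fin d), ((αQ S.card : ℚ) : ℝ) * d.factorial ≤ (disPerms S).card)
    (l : List ℕ) (j N tmax : ℕ) :
    srwW d 1 j (canonSite d l) ≤ ((hybWBoundQ d αQ l (2 * j) N tmax Λ T : ℚ) : ℝ) := by
  set x := canonSite d l with hxdef
  have hJ : jensenSum d 1 (2 * j) x ≤ ((jensenBoundQ d x (2 * j) N tmax Λ T : ℚ) : ℝ) :=
    jensenSum_le_jensenBoundQ hd hT x (2 * j) N tmax
  have h1 : srwW d 1 j x ≤ ((jensenBoundQ d x (2 * j) N tmax Λ T : ℚ) : ℝ) :=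
    (srwW_le_jensenSum (by omega) j x).trans hJ
  have hxx : ∀ σ ∈ disPerms (nzSupp x), srwI d 1 (2 * j) (x + compPerm x σ) ≤ ((xxBoundQ d l (2 * j) N Λ T : ℚ) : ℝ) :=
    fun σ hσ => srwI_add_compPerm_le_xxBoundQ hd hT l (2 * j) N hσ
  have h2 := srwW_le_hybrid_cert (n := 1) (by omega) j x (hα (nzSupp x)) hxx hJ
  unfold hybWBoundQ
  push_cast
  exact le_min h1 h2

/-! ### §3. Far values, tables and the `WBX` cell -/

/-- One Newton step for `√P` from `G`: `(G + P/G)/2`. [folklore] -/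
def newtonStep (P G : ℚ) : ℚ := (G + P / G) / 2

/-- A Newton step stays above the root: `0 ≤ G`, `0 ≤ P ≤ G²` ⟹ `0 ≤ G'` and `P ≤ G'²` for `G' = (G + P/G)/2` (over any
linear ordered field). [cite: FitznerVanDerHofstad2016NoBLE, §5.1.2 (5.16) p. 1092] -/
theorem newtonStep_spec {K : Type*} [Field K] [LinearOrder K] [IsStrictOrderedRing K] {P G : K} (hG : 0 ≤ G)
    (hP : 0 ≤ P) (hPG : P ≤ G ^ 2) : 0 ≤ (G + P / G) / 2 ∧ P ≤ ((G + P / G) / 2) ^ 2 := by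
  by_cases hz : G = 0
  · subst hz
    have hP0 : P = 0 := le_antisymm (by simpa using hPG) hP
    simp [hP0]
  · have hGp : 0 < G := lt_of_le_of_ne hG (Ne.symm hz)
    refine ⟨by positivity, ?_⟩
    have key : ((G + P / G) / 2) ^ 2 - P = ((G - P / G) / 2) ^ 2 := by
      field_simp
      ring
    nlinarith [sq_nonneg ((G - P / G) / 2), key]

/-- Two Newton steps for `√(AB)` from the arithmetic mean (within `~1 %` of the geometric mean down to `B/A ≈ 1/10`).
[folklore] -/
def amgmNewton2 (A B : ℚ) : ℚ := newtonStep (A * B) (amgmNewton A B)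

/-- Round UP to the grid `D⁻¹ℤ` (keeps the class sums on a common denominator). [folklore] -/
def roundUpQ (D : ℕ) (q : ℚ) : ℚ := ((⌈q * D⌉ : ℤ) : ℚ) / D

/-- `q ≤ roundUpQ D q` (`D ≥ 1`). [cite: FitznerVanDerHofstad2016NoBLE, §5.1.2 (5.16) p. 1092] -/
theorem le_roundUpQ {D : ℕ} (hD : 0 < D) (q : ℚ) : q ≤ roundUpQ D q := by
  unfold roundUpQ
  rw [le_div_iff₀ (by exact_mod_cast hD : (0 : ℚ) < D)]
  exact Int.le_ceil _

/-- The grid of the far values: `2^{-80}`. [folklore] -/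
def hybDen : ℕ := 2 ^ 80

/-- **The far-value certificate**: for `0 ≤ A`, `0 ≤ B` the rounded two-step Newton value `F` has `0 ≤ F` and
`A·B ≤ F²`. [cite: FitznerVanDerHofstad2016NoBLE, §5.1.2 (5.16) p. 1092] -/
theorem roundUpQ_amgmNewton2_spec {A B : ℚ} (hA : 0 ≤ A) (hB : 0 ≤ B) {D : ℕ} (hD : 0 < D) :
    0 ≤ roundUpQ D (amgmNewton2 A B) ∧ A * B ≤ roundUpQ D (amgmNewton2 A B) ^ 2 := by
  obtain ⟨h1, h2⟩ : 0 ≤ amgmNewton A B ∧ A * B ≤ amgmNewton A B ^ 2 := amgmNewton_spec hA hB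
  obtain ⟨h3, h4⟩ : 0 ≤ amgmNewton2 A B ∧ A * B ≤ amgmNewton2 A B ^ 2 :=
    newtonStep_spec h1 (mul_nonneg hA hB) h2
  have h5 := le_roundUpQ hD (amgmNewton2 A B)
  exact ⟨h3.trans h5, h4.trans (pow_le_pow_left₀ h3 h5 2)⟩

/-- The hybrid far value of class `l` at cut policy `J` and weight table `αQ`: the two-step Newton value of `√(AB)`,
rounded up to the grid `2^{-80}`, with `A = srwIZeroExtQ d Λ T (2J_i(l))` (`≥ I_{1,2J}(0)`) and
`B = hybWBoundQ d αQ l (2J_i(l)) N tmax Λ T` (`≥ W_{1,J}(x_l)`) — a rational `≥ √(AB) ≥ K_{1,2J}(x_l)`.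
[cite: FitznerVanDerHofstad2016NoBLE, §5.1.2 (5.16) p. 1092] -/
def hybFarQ (d Λ : ℕ) (T : ℕ → ℚ) (N tmax : ℕ) (αQ : ℕ → ℚ) (J : ℕ → List ℕ → ℕ) (i : ℕ) (l : List ℕ) : ℚ :=
  roundUpQ hybDen (amgmNewton2 (srwIZeroExtQ d Λ T (2 * J i l)) (hybWBoundQ d αQ l (2 * J i l) N tmax Λ T))

/-- **`K_{1,2J}(x_l) ≤ ↑(hybFarQ d Λ T N tmax αQ J i l)`** (`d ≥ 3`, origin table `hT`, admissible `αQ`).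
[cite: FitznerVanDerHofstad2016NoBLE, §5.1.2 (5.16) p. 1092] -/
theorem srwK_le_hybFarQ (hd : 3 ≤ d) {Λ : ℕ} {T : ℕ → ℚ} (hT : ∀ l ≤ Λ, srwI d 1 l 0 ≤ (T l : ℝ))
    (N tmax : ℕ) {αQ : ℕ → ℚ} (hα : ∀ S : Finset (Fin d), ((αQ S.card : ℚ) : ℝ) * d.factorial ≤ (disPerms S).card)
    (J : ℕ → List ℕ → ℕ) (i : ℕ) (l : List ℕ) :
    srwK d 1 (2 * J i l) (canonSite d l) ≤ ((hybFarQ d Λ T N tmax αQ J i l : ℚ) : ℝ) := by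
  have hA := srwI_one_zero_le_srwIZeroExtQ hd hT (2 * J i l)
  have hB := srwW_le_hybWBoundQ hd hT hα l (J i l) N tmax
  have hA0 : (0 : ℚ) ≤ srwIZeroExtQ d Λ T (2 * J i l) := by
    exact_mod_cast (srwI_zero_even_nonneg 1 (J i l)).trans hA
  have hB0 : (0 : ℚ) ≤ hybWBoundQ d αQ l (2 * J i l) N tmax Λ T := by
    exact_mod_cast (srwW_nonneg 1 (J i l) _).trans hB
  obtain ⟨hF, hAB⟩ := roundUpQ_amgmNewton2_spec hA0 hB0 (by decide : 0 < hybDen)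
  have hF' : (0 : ℝ) ≤ ((hybFarQ d Λ T N tmax αQ J i l : ℚ) : ℝ) := by
    unfold hybFarQ; exact_mod_cast hF
  have hAB' : ((srwIZeroExtQ d Λ T (2 * J i l) : ℚ) : ℝ) * ((hybWBoundQ d αQ l (2 * J i l) N tmax Λ T : ℚ) : ℝ) ≤
      ((hybFarQ d Λ T N tmax αQ J i l : ℚ) : ℝ) ^ 2 := by
    unfold hybFarQ; exact_mod_cast hAB
  have h := srwK_le_of_srwW_cert (n := 1) (m := J i l) (j := J i l) (by omega) hA hB hF' hAB'
  rwa [← two_mul] at h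

/-- `hybFarLeTable d Λ T N tmax αQ J i f ls`: every class `l ∈ ls` has `hybFarQ d Λ T N tmax αQ J i l ≤ f l` (a `Bool`,
one `decide +kernel` per chunk of classes). [cite: FitznerVanDerHofstad2016NoBLE, §5.3.3 p. 1098; §5.1.2 (5.16) p. 1092] -/
def hybFarLeTable (d Λ : ℕ) (T : ℕ → ℚ) (N tmax : ℕ) (αQ : ℕ → ℚ) (J : ℕ → List ℕ → ℕ) (i : ℕ)
    (f : List ℕ → ℚ) (ls : List (List ℕ)) : Bool :=
  ls.all fun l => decide (hybFarQ d Λ T N tmax αQ J i l ≤ f l)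

/-- Chunking a table check. [cite: FitznerVanDerHofstad2016NoBLE, §5.3.3 p. 1098] -/
theorem hybFarLeTable_of_take_drop {Λ : ℕ} {T : ℕ → ℚ} {N tmax : ℕ} {αQ : ℕ → ℚ} {J : ℕ → List ℕ → ℕ} {i : ℕ}
    {f : List ℕ → ℚ} {ls : List (List ℕ)} (n : ℕ) (h₁ : hybFarLeTable d Λ T N tmax αQ J i f (ls.take n) = true)
    (h₂ : hybFarLeTable d Λ T N tmax αQ J i f (ls.drop n) = true) :
    hybFarLeTable d Λ T N tmax αQ J i f ls = true := by
  rw [← List.take_append_drop n ls]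
  unfold hybFarLeTable at *
  rw [List.all_append, h₁, h₂]; rfl

/-- A certified table dominates `K_{1,2J}(x_l)` on its class list (`d ≥ 3`, origin table `hT`).
[cite: FitznerVanDerHofstad2016NoBLE, §5.1.2 (5.16) p. 1092] -/
theorem srwK_le_of_hybFarLeTable (hd : 3 ≤ d) {Λ : ℕ} {T : ℕ → ℚ} (hT : ∀ l ≤ Λ, srwI d 1 l 0 ≤ (T l : ℝ))
    {N tmax : ℕ} {αQ : ℕ → ℚ} (hα : ∀ S : Finset (Fin d), ((αQ S.card : ℚ) : ℝ) * d.factorial ≤ (disPerms S).card)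
    {J : ℕ → List ℕ → ℕ} {i : ℕ} {f : List ℕ → ℚ} {ls : List (List ℕ)}
    (h : hybFarLeTable d Λ T N tmax αQ J i f ls = true) :
    ∀ l ∈ ls, srwK d 1 (2 * J i l) (canonSite d l) ≤ ((f l : ℚ) : ℝ) := by
  intro l hl
  unfold hybFarLeTable at h
  have h' := (List.all_eq_true.1 h) l hl
  simp only [decide_eq_true_eq] at h'
  exact (srwK_le_hybFarQ hd hT N tmax hα J i l).trans (by exact_mod_cast h')

/-- **The `WBX(M)` cell at the overlay reading, cut policy `J`, HYBRID `W`-SPLIT FAR VALUES read off an origin table of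
any extent** — the binders of `WbxCellExactKernel.toReal_tsum_sq_weighted_repBubble_le_policyXBounds_of_originTable`
verbatim plus the evaluator parameters `N` (law depth), `tmax` (type truncation) and an admissible weight table `αQ`
(`hα`; e.g. `hybAlphaQ_admissible`); every `q i` is one `decide +kernel`.  Pointer language: an input-certification
form, no statement about any dimension.
[cite: FitznerVanDerHofstad2016NoBLE, §5.3.1 (5.36)–(5.38) with §5.3.3 p. 1098; §5.1.2 (5.16) p. 1092; (5.14)]
[cite: FitznerVanDerHofstad2017, §4.2 (4.18)]
[cite: MadrasSlade1993, Cor. 5.3.2 (5.3.3) (reprint PDF p. 148)] -/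
theorem toReal_tsum_sq_weighted_repBubble_le_policyXBounds_hybrid_of_originTable {ι : Type*} [Fintype ι]
    [Nonempty ι] (hd : 3 ≤ d) {p : unitInterval} (hp : p ∈ Set.Ioo (nbwThresholdI d) (criticalProbI d))
    (m M : ℕ) {J : ℕ → List ℕ → ℕ} (hJ : ∀ i ∈ Icc m M, ∀ l ∈ liveList d i, i ≤ 2 * J i l)
    {𝒮 : ι → ℕ × ℕ × Set (Site d)} {cμ : ℝ} {c : ι → ℝ} (hc : ∀ k, 0 < c k) {γ : Fin 3 → ℚ}
    (hΓ : ∀ i, nobleFOf 𝒮 cμ c i p ≤ (γ i : ℝ)) {k : ι} (hk : 𝒮 k = (1, M + 1, {(0 : Site d)}))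
    {z : ℚ} (hpz : (p : ℝ) ≤ (z : ℝ)) {Λ : ℕ} {T : ℕ → ℚ} (hT : ∀ l ≤ Λ, srwI d 1 l 0 ≤ (T l : ℝ)) (N tmax : ℕ)
    {αQ : ℕ → ℚ} (hα : ∀ S : Finset (Fin d), ((αQ S.card : ℚ) : ℝ) * d.factorial ≤ (disPerms S).card)
    {q : ℕ → ℚ} (hq : ∀ i ∈ Icc m M, wbxOrderPolicyXQ d i (J i) z (γ 1) (hybFarQ d Λ T N tmax αQ J i) ≤ q i) :
    (∑' y : Site d, ENNReal.ofReal (euclidNorm y ^ 2) *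
        bondPercolation (zdGraph d) p (openConnGe m (0 : Site d) y □ openConn y 0)).toReal ≤
      (∑ i ∈ Icc m M, (z : ℝ) ^ i * (q i : ℝ)) + (2 * d * (z : ℝ)) ^ (M + 1) * ((γ 2 : ℝ) * c k) :=
  toReal_tsum_sq_weighted_repBubble_le_policyXBounds_of_farValues hd hp m M hJ hc hΓ hk hpz
    (fun i _ l _ => srwK_le_hybFarQ hd hT N tmax hα J i l) hq

/-- **The same cell with a CERTIFIED HYBRID FAR-VALUE TABLE** `f` (`hybFarLeTable … i (f i) (liveList d i) = true` for
each order, provable chunk by chunk with `hybFarLeTable_of_take_drop`), the order evaluator then running on `f`.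
[cite: FitznerVanDerHofstad2016NoBLE, §5.3.1 (5.36)–(5.38) with §5.3.3 p. 1098; §5.1.2 (5.16) p. 1092; (5.14)]
[cite: FitznerVanDerHofstad2017, §4.2 (4.18)]
[cite: MadrasSlade1993, Cor. 5.3.2 (5.3.3) (reprint PDF p. 148)] -/
theorem toReal_tsum_sq_weighted_repBubble_le_policyXBounds_hybridTable_of_originTable {ι : Type*} [Fintype ι]
    [Nonempty ι] (hd : 3 ≤ d) {p : unitInterval} (hp : p ∈ Set.Ioo (nbwThresholdI d) (criticalProbI d))
    (m M : ℕ) {J : ℕ → List ℕ → ℕ} (hJ : ∀ i ∈ Icc m M, ∀ l ∈ liveList d i, i ≤ 2 * J i l)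
    {𝒮 : ι → ℕ × ℕ × Set (Site d)} {cμ : ℝ} {c : ι → ℝ} (hc : ∀ k, 0 < c k) {γ : Fin 3 → ℚ}
    (hΓ : ∀ i, nobleFOf 𝒮 cμ c i p ≤ (γ i : ℝ)) {k : ι} (hk : 𝒮 k = (1, M + 1, {(0 : Site d)}))
    {z : ℚ} (hpz : (p : ℝ) ≤ (z : ℝ)) {Λ : ℕ} {T : ℕ → ℚ} (hT : ∀ l ≤ Λ, srwI d 1 l 0 ≤ (T l : ℝ)) {N tmax : ℕ}
    {αQ : ℕ → ℚ} (hα : ∀ S : Finset (Fin d), ((αQ S.card : ℚ) : ℝ) * d.factorial ≤ (disPerms S).card)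
    {f : ℕ → List ℕ → ℚ} (hf : ∀ i ∈ Icc m M, hybFarLeTable d Λ T N tmax αQ J i (f i) (liveList d i) = true)
    {q : ℕ → ℚ} (hq : ∀ i ∈ Icc m M, wbxOrderPolicyXQ d i (J i) z (γ 1) (f i) ≤ q i) :
    (∑' y : Site d, ENNReal.ofReal (euclidNorm y ^ 2) *
        bondPercolation (zdGraph d) p (openConnGe m (0 : Site d) y □ openConn y 0)).toReal ≤
      (∑ i ∈ Icc m M, (z : ℝ) ^ i * (q i : ℝ)) + (2 * d * (z : ℝ)) ^ (M + 1) * ((γ 2 : ℝ) * c k) :=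
  toReal_tsum_sq_weighted_repBubble_le_policyXBounds_of_farValues hd hp m M hJ hc hΓ hk hpz
    (fun i hi l hl => srwK_le_of_hybFarLeTable hd hT hα (hf i hi) l hl) hq

/-! ### §4. Toy examples (`d = 3`), kernel-decided -/

/-- The canonical point of the doubled class of `e₁` is `e₁ + e₂`; the guard recognises it. -/
example : xxGuard 3 (canonSite 3 [1]) (canonSite 3 (dblClass [1])) = true := by decide +kernel

/-- `α(10, 1) = 9/10`, `α(10, 2) = 3/5`, `α(10, 3) = 1/10`: the disjoint placements dominate for small supports. -/
example : hybAlphaQ 10 1 = 9 / 10 ∧ hybAlphaQ 10 2 = 3 / 5 ∧ hybAlphaQ 10 3 = 1 / 10 := by norm_num [hybAlphaQ]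

/-- For the class of `e₁` at `d = 3` (toy table `T l = l`, `L = 4`, `N = 2`) the hybrid `W`-majorant is strictly below
the Jensen one. -/
example : hybWBoundQ 3 (hybAlphaQ 3) [1] 4 2 3 4 (fun l => (l : ℚ)) <
    jensenBoundQ 3 (canonSite 3 [1]) 4 2 3 4 (fun l => (l : ℚ)) := by
  decide +kernel

/-- A two-class hybrid far-value table against the cap `4`, certified in two chunks. -/
example : hybFarLeTable 3 4 (fun l => (l : ℚ)) 2 3 (hybAlphaQ 3) (fun _ _ => 2) 5 (fun _ => 4) [[1], [2]] = true :=
  hybFarLeTable_of_take_drop 1 (by decide +kernel) (by decide +kernel)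

end Literature.Probability.FitznerVanDerHofstad2017
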